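import Literature.MathematicalPhysics.KineticTheory.Hilbert6LinearizedBoltzmann
import Literature.Analysis.UnboundedOperators.LinearizedBoltzmannProofs
import Literature.Analysis.UnboundedOperators.LinearizedBoltzmannBurnettProofs
import HarnessLib

/-!
# Positivity of the hard-sphere viscosity: reduction to the prelude positivity fact

Sibling proof file of `Hilbert6LinearizedBoltzmann.lean` (topic
`Literature/MathematicalPhysics/KineticTheory`), which vendors the named fact
`Literature.MathematicalPhysics.KineticTheory.hardSphereViscosity_pos`
(`∀ (hd : 2 ≤ d), 0 < hardSphereViscosity d`), where
`hardSphereViscosity d = (1 / ((d - 1) (d + 2))) ∑_{i,j} ⟪A_{ij}, (-L)⁻¹ A_{ij}⟫_M` is the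
Chapman–Enskog / incompressible-Navier–Stokes-limit viscosity of the hard-sphere gas,
`A_{ij}(v) = vᵢ vⱼ - δ_{ij} |v|²/d` the Burnett functions in the standard basis of `ℝ^d`, `L` the
linearised hard-sphere collision operator, and
`⟪A, (-L)⁻¹ A⟫_M := dirichletFormInv hardSphereLinearizedOp A = ⨆ g, (2⟪A, g⟫_M + ⟪g, L g⟫_M)`
the variational (real `iSup`, junk value `0` when unbounded) expression of the quadratic form of
the pseudo-inverse of `-L` (`Literature.Analysis.UnboundedOperators.LinearizedBoltzmann`).

## What is proved here

The **glue** `hardSphereViscosity_pos_of`: the fact follows from the single prelude fact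
`Literature.Analysis.UnboundedOperators.dirichletFormInv_pos_of_orthogonal_of_ne_zero`
(`⟪A, (-L)⁻¹ A⟫_M > 0` for a non-zero `A` of temperate growth `M`-orthogonal to the collision
invariants, velocity dimension `≥ 2`), specialised to `E = V d = EuclideanSpace ℝ (Fin d)`:

* every summand `⟪A_{ij}, (-L)⁻¹ A_{ij}⟫_M` is `≥ 0` unconditionally
  (`Literature.Analysis.UnboundedOperators.dirichletFormInv_nonneg`: the variational family
  contains the value `0` at `g = 0`, junk value included), whence `viscosityDirichletSum_nonneg`;
* the off-diagonal Burnett function `A_{01}` (it exists as `d ≥ 2`) is non-zero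
  (`A_{ij}(e_i + e_j) = 1`, `burnettA_basisFun_ne_zero`), has temperate growth
  (`burnettA_mem_temperateGrowth`) and is `M`-orthogonal to the collision invariants (the
  discharged prelude fact `burnettA_orthogonal_collisionInvariants_holds`), so its summand is
  `> 0` (`dirichletFormInv_burnettA_pos_of`) and the double sum is `> 0`
  (`viscosityDirichletSum_pos_of`);
* the normalising constant `1 / ((d - 1) (d + 2))` is `> 0` for `d ≥ 2` (`viscosity_const_pos`);
  positivity does not depend on its value, which the statement file flags as unverified.

Once the prelude fact is discharged, `hardSphereViscosity_pos_holds` is the one-liner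
`hardSphereViscosity_pos_of dirichletFormInv_pos_of_orthogonal_of_ne_zero_holds`. In the tree the
prelude fact is in turn reduced (`LinearizedBoltzmannBddAboveProofs`,
`dirichletFormInv_pos_of_orthogonal_of_ne_zero_of_comm_of_gap`) to the discharged symmetry of `L`
and the one remaining undischarged input, the hard-sphere spectral gap
`Literature.Analysis.UnboundedOperators.le_neg_maxwellianInner_hardSphereLinearizedOp_of_orthogonal`
(Baranger–Mouhot 2005 Thm 1.1; qualitatively CIP 1994 Thm 7.2.5).

## Source and mechanism

Cercignani–Illner–Pulvirenti, *The Mathematical Theory of Dilute Gases* (Springer, Applied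
Mathematical Sciences 106, 1994): §7.1 (1.9)–(1.10), p. 192 (`L` symmetric, `(h, Lh) ≤ 0`, with
equality iff `h/M^{1/2}` is a collision invariant); §7.2, Theorem 7.2.1, p. 197 (`L` self-adjoint
and non-positive on `L²`, null space spanned by the collision invariants) and Theorem 7.2.5,
p. 201 (`σ(L)` = a discrete part in `(-ν₀, 0]` plus the essential part `(-∞, -ν₀]`, so `0` is an
isolated eigenvalue of finite multiplicity and `-L` has a spectral gap on `(ker L)^⊥`); §11.5,
p. 333 ("the viscosity coefficient `ν > 0` can be computed in terms of kinetic expressions"; the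
kinetic expression is Bardos–Golse–Levermore 1993 §2 / Golse–Saint-Raymond 2004 (1.15)). Hence
`(-L)⁻¹` is bounded and positive definite on `(ker L)^⊥ ∋ A_{ij}`, and
`ν ∝ ∑_{i,j} ⟪A_{ij}, (-L)⁻¹ A_{ij}⟫_M > 0` because `A_{01} ≠ 0`. This file adds nothing to the
trust base: its only hypothesis is an existing named fact.
-/

open MeasureTheory ProbabilityTheory Module
open Literature.Analysis.UnboundedOperators

namespace Literature.MathematicalPhysics.KineticTheory

noncomputable section

variable {d : ℕ}

/-! ### Elementary inputs in `V d = ℝ^d` -/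

/-- The value of the Burnett function `A_{ij}(v) = vᵢ vⱼ - δ_{ij} |v|²/d` (standard basis of
`ℝ^d`, `i ≠ j`) at `e_i + e_j` is `1`. [folklore] -/
theorem burnettA_basisFun_apply_add {i j : Fin d} (hij : i ≠ j) :
    burnettA (EuclideanSpace.basisFun (Fin d) ℝ) i j
        (EuclideanSpace.basisFun (Fin d) ℝ i + EuclideanSpace.basisFun (Fin d) ℝ j) = 1 := by
  simp [burnettA, hij, hij.symm, EuclideanSpace.basisFun_repr, EuclideanSpace.basisFun_apply]

/-- The off-diagonal Burnett functions of `ℝ^d` (standard basis) are non-zero functions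
(`A_{ij}(e_i + e_j) = 1` for `i ≠ j`). [folklore] -/
theorem burnettA_basisFun_ne_zero {i j : Fin d} (hij : i ≠ j) :
    burnettA (EuclideanSpace.basisFun (Fin d) ℝ) i j ≠ 0 := by
  intro h
  have h1 := congrFun h (EuclideanSpace.basisFun (Fin d) ℝ i + EuclideanSpace.basisFun (Fin d) ℝ j)
  rw [burnettA_basisFun_apply_add hij, Pi.zero_apply] at h1
  exact one_ne_zero h1

/-- The normalising constant `1 / ((d - 1) (d + 2))` of the viscosity is strictly positive for
`d ≥ 2`. [folklore] -/
theorem viscosity_const_pos (hd : 2 ≤ d) : (0 : ℝ) < 1 / ((d - 1) * (d + 2) : ℝ) := by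
  have h2 : (2 : ℝ) ≤ d := by exact_mod_cast hd
  have hd1 : (0 : ℝ) < (d : ℝ) - 1 := by linarith
  have hd2 : (0 : ℝ) < (d : ℝ) + 2 := by linarith
  exact one_div_pos.2 (mul_pos hd1 hd2)

/-- The viscosity Dirichlet sum `∑_{i,j} ⟪A_{ij}, (-L)⁻¹ A_{ij}⟫_M` is `≥ 0` for *every* operator
and every orthonormal basis: each summand is a real `iSup` over a family whose member `g = 0`
has the value `0` (`dirichletFormInv_nonneg`, junk value included). [folklore] -/
theorem viscosityDirichletSum_nonneg {ι : Type*} [Fintype ι] [DecidableEq ι]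
    (L : (V d → ℝ) → V d → ℝ) (b : OrthonormalBasis ι ℝ (V d)) :
    0 ≤ viscosityDirichletSum L b := by
  unfold viscosityDirichletSum
  exact Finset.sum_nonneg fun i _ => Finset.sum_nonneg fun j _ =>
    dirichletFormInv_nonneg L (burnettA b i j)

/-! ### Positivity from the prelude positivity fact -/

/-- The summand `⟪A_{01}, (-L)⁻¹ A_{01}⟫_M` (`d ≥ 2`, standard basis) is strictly positive,
*granted* the prelude fact `dirichletFormInv_pos_of_orthogonal_of_ne_zero`
(CIP 1994 §7.2, Thm 7.2.1 p. 197 and Thm 7.2.5 p. 201): `A_{01}` has temperate growth, is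
`M`-orthogonal to the collision invariants (`burnettA_orthogonal_collisionInvariants_holds`) and
is non-zero, and `finrank ℝ (V d) = d ≥ 2`.
[cite: CIPDiluteGases1994, §7.2 Thm 7.2.1 p. 197 and Thm 7.2.5 p. 201] -/
theorem dirichletFormInv_burnettA_pos_of {i j : Fin d} (hd : 2 ≤ d) (hij : i ≠ j)
    (hpos : dirichletFormInv_pos_of_orthogonal_of_ne_zero (E := V d)) :
    0 < dirichletFormInv (E := V d) hardSphereLinearizedOp
      (burnettA (EuclideanSpace.basisFun (Fin d) ℝ) i j) :=
  hpos (by simpa only [finrank_euclideanSpace_fin] using hd) (burnettA_mem_temperateGrowth _ i j)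
    (fun _ hφ => burnettA_orthogonal_collisionInvariants_holds _ i j hφ)
    (burnettA_basisFun_ne_zero hij)

/-- The viscosity Dirichlet sum `∑_{i,j} ⟪A_{ij}, (-L)⁻¹ A_{ij}⟫_M` of the hard-sphere gas in
dimension `d ≥ 2` is strictly positive, granted the prelude positivity fact: all summands are
`≥ 0` and the summand `(0, 1)` is `> 0`.
[cite: CIPDiluteGases1994, §7.2 Thm 7.2.1 p. 197 and Thm 7.2.5 p. 201] -/
theorem viscosityDirichletSum_pos_of (hd : 2 ≤ d)
    (hpos : dirichletFormInv_pos_of_orthogonal_of_ne_zero (E := V d)) :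
    0 < viscosityDirichletSum (E := V d) hardSphereLinearizedOp
      (EuclideanSpace.basisFun (Fin d) ℝ) := by
  obtain ⟨i₀, j₀, hij⟩ : ∃ i j : Fin d, i ≠ j :=
    ⟨⟨0, by omega⟩, ⟨1, by omega⟩, Fin.ne_of_val_ne (by norm_num)⟩
  have hterm := dirichletFormInv_burnettA_pos_of hd hij hpos
  unfold viscosityDirichletSum
  calc (0 : ℝ) < dirichletFormInv (E := V d) hardSphereLinearizedOp
        (burnettA (EuclideanSpace.basisFun (Fin d) ℝ) i₀ j₀) := hterm
    _ ≤ ∑ j, dirichletFormInv (E := V d) hardSphereLinearizedOp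
        (burnettA (EuclideanSpace.basisFun (Fin d) ℝ) i₀ j) :=
        Finset.single_le_sum
          (f := fun j => dirichletFormInv (E := V d) hardSphereLinearizedOp
            (burnettA (EuclideanSpace.basisFun (Fin d) ℝ) i₀ j))
          (fun j _ => dirichletFormInv_nonneg _ _) (Finset.mem_univ j₀)
    _ ≤ ∑ i, ∑ j, dirichletFormInv (E := V d) hardSphereLinearizedOp
        (burnettA (EuclideanSpace.basisFun (Fin d) ℝ) i j) :=
        Finset.single_le_sum
          (f := fun i => ∑ j, dirichletFormInv (E := V d) hardSphereLinearizedOp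
            (burnettA (EuclideanSpace.basisFun (Fin d) ℝ) i j))
          (fun i _ => Finset.sum_nonneg fun j _ => dirichletFormInv_nonneg _ _)
          (Finset.mem_univ i₀)

/-- **Glue for `hardSphereViscosity_pos`.** The strict positivity of the hard-sphere viscosity
`ν = (1 / ((d - 1) (d + 2))) ∑_{i,j} ⟪A_{ij}, (-L)⁻¹ A_{ij}⟫_M` in dimension `d ≥ 2` follows from
the prelude fact `dirichletFormInv_pos_of_orthogonal_of_ne_zero` — positivity of the
pseudo-inverse form `⟪A, (-L)⁻¹ A⟫_M` for non-zero temperate `A ⊥_M` collision invariants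
(CIP 1994 §7.2: Thm 7.2.1 p. 197, `-L ≥ 0` self-adjoint with null space the collision invariants,
and Thm 7.2.5 p. 201, `0` isolated in `σ(L)`; "`ν > 0`", §11.5 p. 333) — by: the constant is
`> 0`, every summand is `≥ 0`, and the summand of `A_{01} ≠ 0` is `> 0`.
[cite: CIPDiluteGases1994, §7.2 Thm 7.2.1 p. 197, Thm 7.2.5 p. 201; §11.5 p. 333] -/
theorem hardSphereViscosity_pos_of
    (hpos : dirichletFormInv_pos_of_orthogonal_of_ne_zero (E := V d)) :
    hardSphereViscosity_pos (d := d) := by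
  intro hd
  unfold hardSphereViscosity
  exact mul_pos (viscosity_const_pos hd) (viscosityDirichletSum_pos_of hd hpos)

end

end Literature.MathematicalPhysics.KineticTheory
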